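/-
Origin: expansion seat `planner-pub-hodgecm-mc-theta-3-g28-0`, handover #S18 2026-08-21T02:34Z md5 4010ca96545f (195 l.; NEW; imports HodgeCM.Model.LiuIndexCentralType (row 2) + HodgeCM.Model.ArchLineSlotType (landed); NEW THEOREM NAMES for audit: HodgeCM.Model.LiuIndex.centralTypeOfTwist_eq_add · HodgeCM.Model.LiuIndex.hasCentralTypeAt_twistBy_ofCMOf_iff_eq · HodgeCM.Model.LiuIndex.I.exists_line_eq_twistBy_ofCMOf_of_eq) (`HOME/mc/pub-hodgecm-mc-theta-3-g28/stage70/HodgeCM/Model/LiuIndexTwistType.lean`, md5 4010ca96545f, 195 lines);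
landed by the second packager p2 gen 17 (p2-g17) in gate run 70 as `HodgeCM/Model/LiuIndexTwistType.lean` (verbatim).
-/
/-
Origin: THETA seat `planner-pub-hodgecm-mc-theta-3-g28-0` (unit pub-hodgecm-mc-theta-3-g28, gen 28 of mc-theta-3: theta supply ∕ second-lift ∕ see-saw lane)
2026-08-21.  #S18 (NEW; child of #S16 r2 `Model/LiuIndexCentralType` and of the LANDED `Model/ArchLineSlotType`).
Target in PKG: `HodgeCM/Model/LiuIndexTwistType.lean` (additive KERNEL leaf beside E; nothing imports it; outside E's import closure).
KERNEL ONLY: the central type of a TWISTED record `(ofCMOf … hGR) ⊗ ĉ` as DATA, under continuity of the archimedean restriction of `ĉ`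
along the centre path.  0 records, nothing cited as a fact, 0 `def … : Prop` closed statements.  Nothing here is a claim of the manuscripts
under adjudication.
-/
import Summits.HodgeConjecture.HodgeCM.Model.LiuIndexCentralType_2
import Summits.HodgeConjecture.HodgeCM.Model.ArchLineSlotType_2

set_option autoImplicit false

/-!
# (J3 ∕ K0) THE CENTRAL TYPE OF A TWISTED RECORD — `LiuIndex.centralTypeOfTwist V a hGR ĉ hĉc`

#S16 r2 §2c gives the record OF RECORD `SplitLineE.ofCMOf V e₁ (vec a) … hGR` its central type `centralTypeOf V a hGR` (the archimedean type
of (F1)'s vacuum character) UNCONDITIONALLY, and §2b types the check for a TWISTED record `(ofCM … s hs) ⊗ ĉ` as the scalar identity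
`ĉ(centre_∞ t) · κ(t) = archWeight L m t`.  A slot that goes through a twisted record (sinst-1's slot 0 `splitLineZeroTwisted = (ofCMOf … hGR₀) ⊗ ĉ₀`,
#1256; at the ν-carrying pin also slot 1, STATUS l.15013) wants the twisted type as DATA too.  This leaf supplies it:

* §1 `centerInf V a : U(1)(L⁺ ⊗ ℝ) →* U(J_V)(𝔸) × U(J_⟨a⟩)(𝔸)`, `t ↦ (u_t · 1_V, 1)` (the centre path of #S16's `HasCentralTypeAt`, as a hom;
  `u_t = infUnitToOne L t` of `Model/ArchLineSlotType`), and `twistInf V a ĉ : U(1)(L⁺ ⊗ ℝ) →* ℂ`, `t ↦ ĉ(pairMap (centerInf t))` — the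
  archimedean restriction of a big character `ĉ : U(J_V ⊗ J_⟨a⟩)(𝔸) →* ℂˣ` along the centre path.
* §2 `centralTypeOfTwist V a hGR ĉ (hĉc : Continuous (twistInf V a ĉ)) := charArchType L (twistInf V a ĉ · lineCenterChar(hGR))` and
  `hasCentralTypeAt_twistBy_ofCMOf_iff_eq : HasCentralTypeAt V a ((ofCMOf … hGR).twistBy ĉ hĉ).s m ↔ m = centralTypeOfTwist V a hGR ĉ hĉc`
  (so the twisted record HAS that type, `hasCentralTypeAt_twistBy_ofCMOf`), with the splitting `centralTypeOfTwist = charArchType (twistInf ĉ) +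
  centralTypeOf` (types add, `charArchType_mul'`).
* §3 the pointed corollary `I.exists_line_eq_twistBy_ofCMOf_of_eq`: from `ρ q = a` and `μ ⟦a⟧ = centralTypeOfTwist V a hGR ĉ hĉc`, an index
  `j : I V ρ μ` over `q` with `line V ρ μ j = (ofCMOf … hGR).twistBy ĉ hĉ` ON THE NOSE.

Continuity of `twistInf V a ĉ` is a HYPOTHESIS here (a `BigChar` carries no topology); for sinst-1's `ĉ₀ = bigCharOfV (adelicCharZero …)` it is the
continuity of the archimedean component of their adelic character, theirs to supply.
-/

noncomputable section

open NumberField NumberField.InfinitePlace NumberField.mixedEmbedding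
open scoped Matrix SchwartzMap Classical
open Literature.NumberTheory.Automorphic Literature.NumberTheory.Automorphic.UnitaryGroup Literature.NumberTheory.Weil1964
open Literature.RepresentationTheory.KonnoKonno2007 Literature.RepresentationTheory.KonnoKonno2007.RealDualPair
open Literature.NumberTheory.GelbartRogawski1991 Literature.NumberTheory.GelbartRogawski1991.UnitaryDualPair
open Literature.Analysis.SegalBargmann
open HodgeCM.Model.SupplyInstance (testFun archEmb)

namespace HodgeCM.Model

open HodgeCM.Model.ArchSideTerm (e₁ testFun_smul lineCenterChar infUnitToOne continuous_infUnitToOne charArchType_mul' forall_mul_eq_archWeight_iff)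

namespace LiuIndex

variable {L : CMField} {ι₁ : (L : Type) →+* ℂ} (V : HermSpace3 L ι₁)

/-! ## §1 The centre path and the archimedean restriction of a big character -/

/-- **the centre path** `t ↦ (u_t · 1_V, 1) ∈ U(J_V)(𝔸) × U(J_⟨a⟩)(𝔸)` as a homomorphism (`u_t = infUnitToOne L t`). [folklore] -/
def centerInf (a : RealScalar L) :
    ↥(Literature.NumberTheory.Automorphic.relNormOneInfUnits (↥(maximalRealSubfield (L : Type))) (L : Type)) →*
      ↥(UnitaryGroup.adelic (↥(maximalRealSubfield (L : Type))) (L : Type) (IsCMField.complexConj (L : Type)) 3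
          (Matrix.diagonal (frameD V))) ×
        ↥(UnitaryGroup.adelic (↥(maximalRealSubfield (L : Type))) (L : Type) (IsCMField.complexConj (L : Type)) 1
          (Matrix.diagonal (RealScalar.vec a))) :=
  MonoidHom.prod ((CMCenter (L : Type) (frameD V)).comp (infUnitToOne (L : Type))) 1

/-- formula (definitional): `centerInf V a t` is the element `(CMCenter (u_t), 1)` of #S16's `HasCentralTypeAt`. [folklore] -/
theorem centerInf_apply (a : RealScalar L) (t : ↥(Literature.NumberTheory.Automorphic.relNormOneInfUnits (↥(maximalRealSubfield (L : Type))) (L : Type))) :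
    centerInf V a t =
      (CMCenter (L : Type) (frameD V)
        ((cmAdelicOneEquivRelNormOne (L : Type)).symm
          (Literature.NumberTheory.Automorphic.relNormOneInfToIdeles (↥(maximalRealSubfield L)) L t)), 1) :=
  rfl

/-- the centre path is continuous. [folklore] -/
theorem continuous_centerInf (a : RealScalar L) : Continuous (centerInf V a) :=
  ((continuous_adelicCenter _ _ _ _ _).comp (continuous_infUnitToOne (L : Type))).prodMk continuous_const

/-- **the archimedean restriction of a big character along the centre path**: `t ↦ ĉ(pairMap (u_t · 1_V, 1)) ∈ ℂ`. [folklore] -/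
def twistInf (a : RealScalar L)
    (ĉ : ↥(UnitaryGroup.adelicPair (↥(maximalRealSubfield (L : Type))) (L : Type) (IsCMField.complexConj (L : Type)) 3 1
        (Matrix.diagonal (frameD V)) (Matrix.diagonal (RealScalar.vec a))) →* ℂˣ) :
    ↥(Literature.NumberTheory.Automorphic.relNormOneInfUnits (↥(maximalRealSubfield (L : Type))) (L : Type)) →* ℂ :=
  (Units.coeHom ℂ).comp
    (ĉ.comp
      ((pairMap (↥(maximalRealSubfield (L : Type))) (L : Type) (IsCMField.complexConj (L : Type)) 3 1 (Matrix.diagonal (frameD V))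
            (Matrix.diagonal (RealScalar.vec a))).comp
        (centerInf V a)))

/-- formula (definitional). [folklore] -/
theorem twistInf_apply (a : RealScalar L)
    (ĉ : ↥(UnitaryGroup.adelicPair (↥(maximalRealSubfield (L : Type))) (L : Type) (IsCMField.complexConj (L : Type)) 3 1
        (Matrix.diagonal (frameD V)) (Matrix.diagonal (RealScalar.vec a))) →* ℂˣ)
    (t : ↥(Literature.NumberTheory.Automorphic.relNormOneInfUnits (↥(maximalRealSubfield (L : Type))) (L : Type))) :
    twistInf V a ĉ t =
      ((ĉ (pairMap (↥(maximalRealSubfield (L : Type))) (L : Type) (IsCMField.complexConj (L : Type)) 3 1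
              (Matrix.diagonal (frameD V)) (Matrix.diagonal (RealScalar.vec a))
              (CMCenter (L : Type) (frameD V)
                ((cmAdelicOneEquivRelNormOne (L : Type)).symm
                  (Literature.NumberTheory.Automorphic.relNormOneInfToIdeles (↥(maximalRealSubfield L)) L t)), 1)) : ℂˣ) : ℂ) :=
  rfl

/-! ## §2 The central type of the twisted record of record -/

/-- the continuous vacuum character of (F1) as a `ℂ`-valued hom (the `κ` of #S16 §2b at the splitting of record). [folklore] -/
abbrev kappaOf (a : RealScalar L)
    (hGR : (cmSplittingDatum (L : Type) e₁ (frameD V) (frameD_real V) (frameD_ne V) (RealScalar.vec a) (RealScalar.vec_real a)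
      (RealScalar.vec_ne a)).CompatibleSplitting) :
    ↥(Literature.NumberTheory.Automorphic.relNormOneInfUnits (↥(maximalRealSubfield (L : Type))) (L : Type)) →* ℂ :=
  Circle.coeHom.comp (lineCenterChar V a.1 a.2.1 a.2.2 hGR)

/-- `κ` is continuous (tree `continuous_lineCenterChar`). [folklore] -/
theorem continuous_kappaOf (a : RealScalar L)
    (hGR : (cmSplittingDatum (L : Type) e₁ (frameD V) (frameD_real V) (frameD_ne V) (RealScalar.vec a) (RealScalar.vec_real a)
      (RealScalar.vec_ne a)).CompatibleSplitting) :
    Continuous (kappaOf V a hGR) :=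
  continuous_subtype_val.comp (HodgeCM.Model.ArchSideTerm.continuous_lineCenterChar V a.1 a.2.1 a.2.2 hGR)

/-- `centralTypeOf` of #S16 §2c is the type of `κ` (definitional). [folklore] -/
theorem centralTypeOf_eq_charArchType_kappaOf (a : RealScalar L)
    (hGR : (cmSplittingDatum (L : Type) e₁ (frameD V) (frameD_real V) (frameD_ne V) (RealScalar.vec a) (RealScalar.vec_real a)
      (RealScalar.vec_ne a)).CompatibleSplitting) :
    centralTypeOf V a hGR = Literature.NumberTheory.Automorphic.charArchType (L : Type) (kappaOf V a hGR) (continuous_kappaOf V a hGR) :=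
  rfl

/-- **the central type of the twisted record `(ofCMOf … hGR) ⊗ ĉ`** (DATA), under continuity of `twistInf V a ĉ`: the archimedean type of the
continuous character `twistInf ĉ · κ`. [BrockerTomDieck1985, Ch. II Def. 8.2; folklore] -/
def centralTypeOfTwist (a : RealScalar L)
    (hGR : (cmSplittingDatum (L : Type) e₁ (frameD V) (frameD_real V) (frameD_ne V) (RealScalar.vec a) (RealScalar.vec_real a)
      (RealScalar.vec_ne a)).CompatibleSplitting)
    (ĉ : ↥(UnitaryGroup.adelicPair (↥(maximalRealSubfield (L : Type))) (L : Type) (IsCMField.complexConj (L : Type)) 3 1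
        (Matrix.diagonal (frameD V)) (Matrix.diagonal (RealScalar.vec a))) →* ℂˣ)
    (hĉc : Continuous (twistInf V a ĉ)) : InfinitePlace (L : Type) → ℤ :=
  Literature.NumberTheory.Automorphic.charArchType (L : Type) (twistInf V a ĉ * kappaOf V a hGR) (hĉc.mul (continuous_kappaOf V a hGR))

/-- **types add**: `centralTypeOfTwist = charArchType (twistInf ĉ) + centralTypeOf`. [folklore] -/
theorem centralTypeOfTwist_eq_add (a : RealScalar L)
    (hGR : (cmSplittingDatum (L : Type) e₁ (frameD V) (frameD_real V) (frameD_ne V) (RealScalar.vec a) (RealScalar.vec_real a)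
      (RealScalar.vec_ne a)).CompatibleSplitting)
    (ĉ : ↥(UnitaryGroup.adelicPair (↥(maximalRealSubfield (L : Type))) (L : Type) (IsCMField.complexConj (L : Type)) 3 1
        (Matrix.diagonal (frameD V)) (Matrix.diagonal (RealScalar.vec a))) →* ℂˣ)
    (hĉc : Continuous (twistInf V a ĉ)) :
    centralTypeOfTwist V a hGR ĉ hĉc =
      Literature.NumberTheory.Automorphic.charArchType (L : Type) (twistInf V a ĉ) hĉc + centralTypeOf V a hGR :=
  charArchType_mul' (L : Type) _ _ hĉc (continuous_kappaOf V a hGR) _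

/-- **THE TYPE CHECK OF THE TWISTED RECORD OF RECORD IS `m = centralTypeOfTwist`**:
`HasCentralTypeAt V a ((ofCMOf … hGR).twistBy ĉ hĉ).s m ↔ m = centralTypeOfTwist V a hGR ĉ hĉc` (#S16 §2b `hasCentralTypeAt_twistBy_iff` at
`κ = lineCenterChar(hGR)` + `forall_mul_eq_archWeight_iff`). [GelbartRogawski1991, §3.1 Remark p. 457 L4–13; BrockerTomDieck1985, Ch. II Prop. 8.1; folklore] -/
theorem hasCentralTypeAt_twistBy_ofCMOf_iff_eq (a : RealScalar L)
    (hGR : (cmSplittingDatum (L : Type) e₁ (frameD V) (frameD_real V) (frameD_ne V) (RealScalar.vec a) (RealScalar.vec_real a)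
      (RealScalar.vec_ne a)).CompatibleSplitting)
    (ĉ : (SplitLineE.ofCMOf V e₁ (RealScalar.vec a) (RealScalar.vec_real a) (RealScalar.vec_ne a) hGR).BigChar)
    (hĉ : (SplitLineE.ofCMOf V e₁ (RealScalar.vec a) (RealScalar.vec_real a) (RealScalar.vec_ne a) hGR).IsRatTrivial ĉ)
    (hĉc : Continuous (twistInf V a ĉ)) (m : InfinitePlace (L : Type) → ℤ) :
    HasCentralTypeAt V a
        ((SplitLineE.ofCMOf V e₁ (RealScalar.vec a) (RealScalar.vec_real a) (RealScalar.vec_ne a) hGR).twistBy ĉ hĉ).s m ↔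
      m = centralTypeOfTwist V a hGR ĉ hĉc := by
  rw [hasCentralTypeAt_twistBy_iff V a _ _ (kappaOf V a hGR) (pairRep_splittingOf_center_testFun_gaussianAt V a hGR) ĉ hĉ m,
    centralTypeOfTwist, eq_comm, ← forall_mul_eq_archWeight_iff (L : Type) (twistInf V a ĉ) (kappaOf V a hGR)]
  rfl

/-- hence **the twisted record of record HAS the central type `centralTypeOfTwist`**. [folklore] -/
theorem hasCentralTypeAt_twistBy_ofCMOf (a : RealScalar L)
    (hGR : (cmSplittingDatum (L : Type) e₁ (frameD V) (frameD_real V) (frameD_ne V) (RealScalar.vec a) (RealScalar.vec_real a)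
      (RealScalar.vec_ne a)).CompatibleSplitting)
    (ĉ : (SplitLineE.ofCMOf V e₁ (RealScalar.vec a) (RealScalar.vec_real a) (RealScalar.vec_ne a) hGR).BigChar)
    (hĉ : (SplitLineE.ofCMOf V e₁ (RealScalar.vec a) (RealScalar.vec_real a) (RealScalar.vec_ne a) hGR).IsRatTrivial ĉ)
    (hĉc : Continuous (twistInf V a ĉ)) :
    HasCentralTypeAt V a
        ((SplitLineE.ofCMOf V e₁ (RealScalar.vec a) (RealScalar.vec_real a) (RealScalar.vec_ne a) hGR).twistBy ĉ hĉ).s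
      (centralTypeOfTwist V a hGR ĉ hĉc) :=
  (hasCentralTypeAt_twistBy_ofCMOf_iff_eq V a hGR ĉ hĉ hĉc _).2 rfl

/-! ## §3 The pointed corollary for a twisted record -/

variable (ρ : GramClass L → RealScalar L)

variable {ρ} in
/-- **at the pin, the twisted record of record is an index line of recipe `μ` iff the recipe reads its own central type at its class**:
the hypothesis-free form of #S16 `I.exists_line_eq_twistBy` at the splitting of record. [folklore] -/
theorem I.exists_line_eq_twistBy_ofCMOf_of_eq (μ : GramClass L → (InfinitePlace (L : Type) → ℤ)) {q : GramClass L} {a : RealScalar L}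
    (h : ρ q = a)
    (hGR : (cmSplittingDatum (L : Type) e₁ (frameD V) (frameD_real V) (frameD_ne V) (RealScalar.vec a) (RealScalar.vec_real a)
      (RealScalar.vec_ne a)).CompatibleSplitting)
    (ĉ : (SplitLineE.ofCMOf V e₁ (RealScalar.vec a) (RealScalar.vec_real a) (RealScalar.vec_ne a) hGR).BigChar)
    (hĉ : (SplitLineE.ofCMOf V e₁ (RealScalar.vec a) (RealScalar.vec_real a) (RealScalar.vec_ne a) hGR).IsRatTrivial ĉ)
    (hĉc : Continuous (twistInf V a ĉ)) (hμ : μ (GramClass.mk a) = centralTypeOfTwist V a hGR ĉ hĉc) :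
    ∃ j : I V ρ μ, j.1 = q ∧
      line V ρ μ j = (SplitLineE.ofCMOf V e₁ (RealScalar.vec a) (RealScalar.vec_real a) (RealScalar.vec_ne a) hGR).twistBy ĉ hĉ :=
  I.exists_line_eq_twistBy V μ h _ _ ĉ hĉ ((hasCentralTypeAt_twistBy_ofCMOf_iff_eq V a hGR ĉ hĉ hĉc _).2 hμ)

end LiuIndex

end HodgeCM.Model

end
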